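import Literature.NumberTheory.EllipticCurves.TakahashiDegreeFormulaCoprimeProofs
import Literature.NumberTheory.EllipticCurves.EichlerBasisTheoremOfTraceIdentity
import Literature.NumberTheory.EllipticCurves.TakahashiDegreeFormulaFromDictionaryHolds
import HarnessLib

/-!
# Stub ideas k3 (FAMILY 3 — probe the extremes) for `stub_takahashi`
# (`takahashi2001_thm_2_3_of_coprime`), crux `DefiniteRTControlPrime`, route `DefiniteXi`

Helper-lemma signatures (elaboration sanity only; `sorry` allowed here, this file is a scratch
sketch in the ideator's folder, not a proposal).  H0–H4 = Plan A (split the fact at `r ∥ N` into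
its quaternionic half — rank one, reducible in-tree to Pizer's trace identity (2.8) at `r = 0`,
general `M` — and its geometric half, the character-group dictionary); H5 = the necessity lemma
(the stub FORCES rank one, because `ξ` is junk `0` off rank one).
-/

noncomputable section

open scoped BigOperators Matrix MatrixGroups ModularForm ArithmeticFunction.sigma
open CongruenceSubgroup ArithmeticFunction

namespace Summit.ABC.ABC.Cruxes.DefiniteRTControlPrime.StubIdeas3

open Literature.NumberTheory.EllipticCurves Literature.NumberTheory.EllipticCurves.ModularForms
open Literature.NumberTheory.Automorphic Literature.NumberTheory.Automorphic.Brandt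
open Literature.NumberTheory.Automorphic.HeckeTraceFormulaGL2Level
open Literature.NumberTheory.EllipticCurves.BrandtJL

/-- **H1 (named-fact candidate).** Rank one of the `a(W)`-eigen-lattice of the Brandt matrices at
`r ∥ N`: the `M.Coprime r` twin of `takahashi2001_brandtEigenLattice_rank_one` (Takahashi 2001
p. 78; Pizer 1980 Thm. 2.28 at `r = 0`, `M` ANY positive integer prime to `p`, Def. 1.2). -/
def brandtEigenLattice_rank_one_of_coprime : Prop :=
  ∀ (W : WeierstrassCurve ℚ) [W.IsElliptic] (M r : ℕ) [NeZero (M * r)],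
    r.Prime → M.Coprime r → W.conductorNorm ℤ = M * r →
    ∀ (_P : ModularParametrizationData W (M * r)) (S : Brandt.XiSetup M r)
      [Fintype (Brandt.ClassSet S.O)],
      Module.finrank ℤ
        (Brandt.eigenLattice (M * r) (Brandt.matrix S.O) (fun n => W.LFunction n)) = 1

/-- **H0 (named-fact candidate).** Pizer 1980 Thm. 2.25 (2.8) at `r = 0`, weight 2, for an
Eichler order of level `M` in the definite quaternion algebra of prime discriminant `r`,
`M ≥ 1` ARBITRARY with `gcd(M, r) = 1` (= Hijikata–Saito 1973 Lemma 1, Pizer Remark 2.26):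
`tr T_n|S₂(Mr) = tr B(n; r, M) - σ₁(n) + 2 tr T_n|S₂(M)` for `(n, Mr) = 1`. -/
def pizerTraceIdentity_of_coprime : Prop :=
  ∀ (M r : ℕ) [NeZero M] [NeZero (M * r)], r.Prime → M.Coprime r →
    ∀ (S : Brandt.XiSetup M r) [Fintype (Brandt.ClassSet S.O)], ∀ n : ℕ, 0 < n → n.Coprime (M * r) →
      cuspidalHeckeTrace (M * r) 2 1 n =
        (((Brandt.matrix S.O n).trace : ℤ) : ℂ) - ((σ 1 n : ℕ) : ℂ) + 2 * cuspidalHeckeTrace M 2 1 n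

/-- **H1 from H0** (one prover cycle; mirror of
`takahashi2001_brandtEigenLattice_rank_one_of_traceIdentity`, whose engine
`finrank_eigenLattice_eq_one_of_traceIdentity` has NO square-free hypothesis). -/
theorem rank_one_of_coprime_of_traceIdentity (h : pizerTraceIdentity_of_coprime) :
    brandtEigenLattice_rank_one_of_coprime := by
  intro W _ M r _ hr hcop _hN P S _
  haveI : NeZero M := ⟨fun h0 => NeZero.ne (M * r) (by rw [h0, zero_mul])⟩
  exact finrank_eigenLattice_eq_one_of_traceIdentity S (h M r hr hcop S) W hr.one_lt P

/-- **H1, square-free case: already a theorem of the tree** (Eichler–Selberg via Popa). -/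
theorem rank_one_of_coprime_squarefree_case (W : WeierstrassCurve ℚ) [W.IsElliptic] (M r : ℕ)
    [NeZero (M * r)] (hr : r.Prime) (hsq : Squarefree (M * r)) (hN : W.conductorNorm ℤ = M * r)
    (P : ModularParametrizationData W (M * r)) (S : Brandt.XiSetup M r)
    [Fintype (Brandt.ClassSet S.O)] :
    Module.finrank ℤ
      (Brandt.eigenLattice (M * r) (Brandt.matrix S.O) (fun n => W.LFunction n)) = 1 :=
  takahashi2001_brandtEigenLattice_rank_one_holds W M r hr hsq hN P S

/-- **H2 (named-fact candidate).** The character-group dictionary at `r ∥ N`: the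
`M.Coprime r` twin of `takahashi2001_characterGroupDictionary`, minimality restricted to curves
of conductor `M r` (Conrad–Stein 2001 Thm. 6.1, Cor. 6.6, §7.1 (`N = Mp`, `M` arbitrary);
Kohel 2001 Thm. 4.3 (`D = 1`); SGA7 IX 11.5; BLR Thm. 7.5.4). -/
def characterGroupDictionary_of_coprime : Prop :=
  ∀ (W : WeierstrassCurve ℚ) [W.IsElliptic] (M r : ℕ) [NeZero (M * r)],
    r.Prime → M.Coprime r → W.conductorNorm ℤ = M * r →
    ∀ P : ModularParametrizationData W (M * r),
      (∀ (W' : WeierstrassCurve ℚ) [W'.IsElliptic], W'.conductorNorm ℤ = M * r →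
          ∀ P' : ModularParametrizationData W' (M * r),
          P'.f = P.f → P.modularDegree ≤ P'.modularDegree) →
      ∀ (S : Brandt.XiSetup M r) [Fintype (Brandt.ClassSet S.O)],
        ∃ (X : Submodule ℤ (Brandt.ClassSet S.O → ℤ)) (pb : ℤ →ₗ[ℤ] X) (pf : X →ₗ[ℤ] ℤ),
          (∀ (a : ℤ) (y : X),
              ∑ i, (Brandt.weight S.O i : ℤ) * (pb a : Brandt.ClassSet S.O → ℤ) i *
                  (y : Brandt.ClassSet S.O → ℤ) i =
                ((W.minimalDiscriminantNorm ℤ).factorization r : ℤ) * a * pf y) ∧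
          (∀ a : ℤ, pf (pb a) = (P.modularDegree : ℤ) * a) ∧
          Function.Surjective pf ∧
          (∀ (m : ℤ) (v : Brandt.ClassSet S.O → ℤ), m ≠ 0 → m • v ∈ X → v ∈ X) ∧
          (pb 1 : Brandt.ClassSet S.O → ℤ) ∈
            Brandt.eigenLattice (M * r) (Brandt.matrix S.O) (fun n => W.LFunction n)

/-- **H3 (assembly, one prover cycle): H1 + H2 ⇒ the stub**, through the tree's
`takahashi2001_thm_2_3_of_coprime_of_brandtDictionary_one'` (`∀ S` is discharged there by
`Brandt.XiSetup.xi_eq_xi`; setups exist by `nonempty_xiSetup'`). -/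
theorem stub_takahashi_of_split (h₁ : brandtEigenLattice_rank_one_of_coprime)
    (h₂ : characterGroupDictionary_of_coprime) : takahashi2001_thm_2_3_of_coprime := by
  refine takahashi2001_thm_2_3_of_coprime_of_brandtDictionary_one' ?_
  intro W _ M r _ hr hcop hN P hmin hne
  obtain ⟨S⟩ := hne
  classical
  letI : Fintype (Brandt.ClassSet S.O) := Fintype.ofFinite _
  obtain ⟨X, pb, pf, hadj, hδ, hsurj, hXsat, hmem⟩ := h₂ W M r hr hcop hN P hmin S
  exact ⟨S, inferInstance, X, pb, pf, hadj, hδ, hsurj, hXsat, h₁ W M r hr hcop hN P S, hmem⟩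

/-- **H5 (necessity; the extremes finding).** The stub FORCES the eigen-lattice to be a line in
EVERY Brandt setup of type `(M, r)` — `M` arbitrary coprime to `r`, e.g. `M = 2⁸ M'` for Frey
curves — because `Brandt.xi` is the junk value `0` off rank one while `δ ≥ 1`.  So H1 is not a
convenience of Plan A: any proof of the stub proves H1. -/
theorem eigenLattice_isLine_of_stub (h : takahashi2001_thm_2_3_of_coprime)
    (W : WeierstrassCurve ℚ) [W.IsElliptic] (M r : ℕ) [NeZero (M * r)] (hr : r.Prime)
    (hcop : M.Coprime r) (hN : W.conductorNorm ℤ = M * r)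
    (P : ModularParametrizationData W (M * r))
    (hmin : ∀ (W' : WeierstrassCurve ℚ) [W'.IsElliptic], W'.conductorNorm ℤ = M * r →
      ∀ P' : ModularParametrizationData W' (M * r),
        P'.f = P.f → P.modularDegree ≤ P'.modularDegree)
    (S : Brandt.XiSetup M r) [Fintype (Brandt.ClassSet S.O)] :
    ∃ φ : Brandt.ClassSet S.O → ℤ, φ ≠ 0 ∧
      Brandt.eigenLattice (M * r) (Brandt.matrix S.O) (fun n => W.LFunction n) = ℤ ∙ φ := by
  by_contra hline
  have hpos := takahashi2001_thm_2_3_of_coprime.xi_pos h W M r hr hcop hN P hmin S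
  have h0 : S.xi (fun n => W.LFunction n) = 0 := by
    show Brandt.xiOfOrder S.O (M * r) (fun n => W.LFunction n) = 0
    rw [Brandt.xiOfOrder_eq, Brandt.xi_of_not_isLine _ hline]
  rw [h0] at hpos
  exact lt_irrefl 0 hpos

/-- **H6 (Plan C probe: the consumed inequality).** What the skeleton actually uses of the stub
(`Lines/Sketch.lean` L218–220, via `modularDegree_le_brandtXi_mul`): `δ ≤ ξ_S · ord_r Δ_min`.
Weaker as a statement, NOT easier: it still forces the line (same proof as H5, `δ ≥ 1`) and still
needs optimality (`m ∣ c` comes from `π_*` onto). Recorded so the critic does not reshape. -/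
def degLeXiMul_of_coprime : Prop :=
  ∀ (W : WeierstrassCurve ℚ) [W.IsElliptic] (M r : ℕ) [NeZero (M * r)],
    r.Prime → M.Coprime r → W.conductorNorm ℤ = M * r →
    ∀ P : ModularParametrizationData W (M * r),
      (∀ (W' : WeierstrassCurve ℚ) [W'.IsElliptic], W'.conductorNorm ℤ = M * r →
          ∀ P' : ModularParametrizationData W' (M * r),
          P'.f = P.f → P.modularDegree ≤ P'.modularDegree) →
      ∀ S : Brandt.XiSetup M r,
        P.modularDegree ≤ S.xi (fun n => W.LFunction n) * (W.minimalDiscriminantNorm ℤ).factorization r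

theorem degLeXiMul_of_stub (h : takahashi2001_thm_2_3_of_coprime) : degLeXiMul_of_coprime :=
  fun W _ M r _ hr hcop hN P hmin S =>
    takahashi2001_thm_2_3_of_coprime.modularDegree_le_xi_mul h W M r hr hcop hN P hmin S

end Summit.ABC.ABC.Cruxes.DefiniteRTControlPrime.StubIdeas3

end
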